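import Literature.AlgebraicGeometry.AbelianSchemes.LevelBasisFiniteEtaleCover
import Literature.AlgebraicGeometry.AbelianSchemes.PolarizationHatLevelStructureOfFiniteType
import Literature.AlgebraicGeometry.AbelianSchemes.AbelianSchemeOverFibreDim
import Literature.GroupTheory.FiniteAbelian.OrderStatisticsCriterion
import HarnessLib

/-!
# The finite étale cover of level-`M` bases of an abelian scheme is SURJECTIVE
# (`X[M]` is étale-locally `(ℤ/M)^{2g}`: a level-`M` structure exists over a finite étale cover of the base)

Layer `Literature/AlgebraicGeometry/AbelianSchemes`; namespaces `Literature.AlgebraicGeometry.AbelianSchemes.LevelBasis` (§1,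
pure group theory) and `Literature.AlgebraicGeometry.AbelianSchemes.AbelianSchemeOver` (§2–§3).  Cell `hodgecm-mathlib` (D-0151),
F-DAG (W3-cover) C4, consumer F-10 (b) «a level-`N` triple over `T` acquires a level structure over an ÉTALE COVER `T′ → T`»
(author B-p02 (g12)); count-neutral capital, PROOF lane, theorems only (no definition, no named fact, no instance, no
`sorry`).  HC_CM is proved only modulo the 7 printed citations until rung 0 closes; this file asserts nothing about HC.

★ `LevelBasisFiniteEtaleCover.exists_finite_etale_levelStructure` ([MumfordFogartyKirwan1994] Prop. 7.3, proof, step (IV);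
[GortzWedhorn2023] Prop. 27.188 (1)) produces, for an abelian scheme `A/S` of relative dimension `g` with commutative group
law and `M ≠ 0` invertible in the residue fields of `S`, a FINITE ÉTALE `b : B → S` with a level-`M` structure on `A ×_S B`
REALISING every ordered `ℤ/M`-basis of the `M`-torsion of a fibre `A_s(Ω)` by a point of `B` over `s`.  This file adds
that `b` is SURJECTIVE — i.e. `{b}` is a finite étale covering of `S` over which a level-`M` structure exists — because
every GEOMETRIC fibre has such a basis:

* §1 (group theory) `LevelBasis.exists_mulHom_injective_of_forall_dvd_natCard_pow_eq_one` — in a commutative group `G` whose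
  `d`-torsion has exactly `d ^ r` elements for every `d ∣ M` (`M ≥ 1`), there is an INJECTIVE homomorphism
  `(ℤ/M)^r → G` (written multiplicatively, `Multiplicative (J → ZMod M) →* G`, `|J| = r`) whose image is the `M`-torsion
  (`…_range_eq`): the `M`-torsion subgroup is finite with the order statistics `|G[M][n]| = gcd(n, M)^r` of `(ℤ/M)^r`, so
  the tree's criterion ★ `GroupTheory.FiniteAbelian.nonempty_addEquiv_of_forall_natCard_nsmul_eq_zero_eq` ([Hungerford1974]
  Ch. II Cor. 2.7, [Rotman1984] Ex. 6.17) applies; `exists_basis_of_forall_dvd_natCard_pow_eq_one` — the same as an ordered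
  basis `x : Fin g ⊕ Fin g → G` on which `a ↦ Σ aᵢ xᵢ` (the ordered products of ★ `LevelBasisFiniteEtaleCover`) is injective;
* §2 `AbelianSchemeOver.exists_mulHom_torsion_fibrePoints` / `exists_torsionBasis_fibrePoints` — **`A_s̄(Ω)[M] ≅ (ℤ/M)^{2g}`**
  in the `FibrePoints` currency at a geometric point `s̄ : Spec Ω → S` (`Ω` algebraically closed, `M` invertible in `Ω`),
  from the COUNT ★ `natCard_fibrePoints_pow_eq_one` (`#A_s̄(Ω)[d] = d^{2 dim}`, [MumfordAV1970] §6 App. 3) at every `d ∣ M`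
  and ★ `dim_fibre_of_isOfRelDim` (`dim A_s̄ = g`);
* §3 **`AbelianSchemeOver.exists_finite_etale_surjective_levelStructure`** — the cover of ★ `exists_finite_etale_levelStructure`
  is surjective: a point `p ∈ S` lies under the geometric point `Spec κ(p)^{alg} → S`, whose fibre carries a basis (§2),
  realised by a point of `B` (the realisation clause); `M` is invertible in `κ(p)^{alg}` by ★ `natCast_ne_zero_of_residueField`.

## References
* [MumfordFogartyKirwan1994] D. Mumford, J. Fogarty, F. Kirwan, *Geometric Invariant Theory*, 3rd ed. (1994), Ch. 7 §2
  Definition 7.1 (p. 129), Proposition 7.3, proof, step (IV) (pp. 133–134); Ch. 7 §3 Lemma 7.11 (p. 140).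
* [GortzWedhorn2023] U. Görtz, T. Wedhorn, *Algebraic Geometry II* (2023), Prop. 27.188 (1) (p. 675).
* [MumfordAV1970] D. Mumford, *Abelian Varieties* (1970), §6 Application 3 (Proposition p. 64).
* [Hungerford1974] T. W. Hungerford, *Algebra* (1974), Ch. II Lemma 2.5 (vi), Cor. 2.7 (PDF p. 137–140).
* [Rotman1984] J. J. Rotman, *An Introduction to the Theory of Groups*, 3rd ed. (1984), Exercise 6.17.
* [GortzWedhorn2020] U. Görtz, T. Wedhorn, *Algebraic Geometry I*, 2nd ed. (2020), Section (4.7), (4.7.1) (p. 108).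
-/

noncomputable section

universe u

open CategoryTheory CategoryTheory.Limits AlgebraicGeometry MonoidalCategory CartesianMonoidalCategory

open scoped MonObj Obj

namespace Literature.AlgebraicGeometry.AbelianSchemes

/-! ### §1 A `ℤ/M`-basis of the `M`-torsion from the torsion counts `|G[d]| = d ^ r`, `d ∣ M` -/

namespace LevelBasis

open Literature.GroupTheory.FiniteAbelian

/-- `x ^ M = 1 ∧ x ^ n = 1 ↔ x ^ gcd(n, M) = 1` in a monoid (Mathlib `pow_gcd_eq_one`, reordered).
[cite: Hungerford1974, Ch. II Lemma 2.5 (vi), Cor. 2.7 (PDF p. 137–140)] -/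
theorem pow_eq_one_and_pow_eq_one_iff {G : Type*} [Monoid G] (x : G) (M n : ℕ) :
    x ^ M = 1 ∧ x ^ n = 1 ↔ x ^ Nat.gcd n M = 1 := by
  rw [pow_gcd_eq_one]
  exact and_comm

/-- The order statistics of `(ℤ/M)^J`: `|{a : J → ℤ/M | n • a = 0}| = gcd(n, M)^{|J|}` (★ `natCard_nsmul_eq_zero_pi`, ★
`natCard_nsmul_eq_zero_zmod`). [cite: Hungerford1974, Ch. II Lemma 2.5 (vi), Cor. 2.7 (PDF p. 137–140)] -/
theorem natCard_nsmul_eq_zero_pi_zmod (J : Type*) [Fintype J] (M : ℕ) [NeZero M] (n : ℕ) :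
    Nat.card {a : J → ZMod M // n • a = 0} = Nat.gcd n M ^ Fintype.card J := by
  rw [natCard_nsmul_eq_zero_pi (fun _ : J => ZMod M) n]
  simp only [natCard_nsmul_eq_zero_zmod, Finset.prod_const, Finset.card_univ]

/-- The order statistics of the `M`-torsion subgroup `K = {x | x ^ M = 1}` of a commutative group, read additively:
`|{y ∈ K | n • y = 0}| = |{x ∈ G | x ^ gcd(n, M) = 1}|`. [cite: Hungerford1974, Ch. II Lemma 2.5 (vi), Cor. 2.7 (PDF p. 137–140)] -/
theorem natCard_nsmul_eq_zero_additive_ker_powMonoidHom {G : Type*} [CommGroup G] (M n : ℕ) :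
    Nat.card {y : Additive (powMonoidHom M : G →* G).ker // n • y = 0} =
      Nat.card {x : G // x ^ Nat.gcd n M = 1} := by
  let K : Subgroup G := (powMonoidHom M : G →* G).ker
  have hK : ∀ x : G, x ∈ K ↔ x ^ M = 1 := fun x => by
    rw [MonoidHom.mem_ker, powMonoidHom_apply]
  refine Nat.card_congr ((Equiv.subtypeEquiv Additive.toMul fun y => ?_).trans
    ((Equiv.subtypeSubtypeEquivSubtypeInter (fun x : G => x ∈ K) (fun x => x ^ n = 1)).trans
      (Equiv.subtypeEquivRight fun x => ?_)))
  · -- `n • y = 0 ↔ ((toMul y : K) : G) ^ n = 1`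
    change n • y = 0 ↔ ((Additive.toMul y : K) : G) ^ n = 1
    rw [← Additive.toMul.injective.eq_iff, toMul_nsmul, toMul_zero, Subtype.ext_iff, Subgroup.coe_pow,
      Subgroup.coe_one]
  · rw [hK]
    exact pow_eq_one_and_pow_eq_one_iff x M n

/-- **An injective `(ℤ/M)^r → G` from the torsion counts.**  Let `G` be a commutative group and `M ≥ 1` such that
`|{x ∈ G | x ^ d = 1}| = d ^ r` for every `d ∣ M`, and `|J| = r`.  Then there is an INJECTIVE homomorphism
`φ : Multiplicative (J → ℤ/M) →* G`: the `M`-torsion subgroup `K` is finite of order `M ^ r` with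
`|K[n]| = |G[gcd(n, M)]| = gcd(n, M)^r = |((ℤ/M)^J)[n]|` for all `n ≥ 1`, so `K ≅ (ℤ/M)^J` by the order-statistics
criterion ★ `nonempty_addEquiv_of_forall_natCard_nsmul_eq_zero_eq`. [cite: Hungerford1974, Ch. II Lemma 2.5 (vi), Cor. 2.7 (PDF p. 137–140)]
[cite: Rotman1984, Exercise 6.17] -/
theorem exists_mulHom_injective_range_eq_of_forall_dvd_natCard_pow_eq_one {G : Type*} [CommGroup G] {M r : ℕ}
    (hM : 0 < M) (h : ∀ d, d ∣ M → Nat.card {x : G // x ^ d = 1} = d ^ r) (J : Type*) [Fintype J]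
    (hJ : Fintype.card J = r) :
    ∃ φ : Multiplicative (J → ZMod M) →* G, Function.Injective φ ∧ Set.range φ = {x | x ^ M = 1} := by
  classical
  haveI : NeZero M := ⟨hM.ne'⟩
  let K : Subgroup G := (powMonoidHom M : G →* G).ker
  have hK : ∀ x : G, x ∈ K ↔ x ^ M = 1 := fun x => by
    rw [MonoidHom.mem_ker, powMonoidHom_apply]
  have hKcard : Nat.card K = M ^ r := by
    rw [← h M dvd_rfl]
    exact Nat.card_congr (Equiv.subtypeEquivRight hK)
  haveI : Finite K := Nat.finite_of_card_ne_zero (by rw [hKcard]; exact pow_ne_zero _ hM.ne')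
  have hcount : ∀ n, 0 < n →
      Nat.card {a : J → ZMod M // n • a = 0} = Nat.card {y : Additive K // n • y = 0} := by
    intro n _
    rw [natCard_nsmul_eq_zero_pi_zmod J M n, hJ, natCard_nsmul_eq_zero_additive_ker_powMonoidHom M n,
      h (Nat.gcd n M) (Nat.gcd_dvd_right n M)]
  obtain ⟨e⟩ := nonempty_addEquiv_of_forall_natCard_nsmul_eq_zero_eq (J → ZMod M) (Additive K) hcount
  let ψ : Multiplicative (J → ZMod M) ≃* K := AddEquiv.toMultiplicativeLeft e
  have hinj : Function.Injective (K.subtype.comp ψ.toMonoidHom) := K.subtype_injective.comp ψ.injective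
  refine ⟨K.subtype.comp ψ.toMonoidHom, hinj, ?_⟩
  -- the image is the whole `M`-torsion: it lies inside (exponent `M`) and has the same finite cardinality
  apply Set.eq_of_subset_of_ncard_le
  · rintro _ ⟨v, rfl⟩
    exact (hK _).1 (ψ v).2
  · have hsrc : Nat.card (Multiplicative (J → ZMod M)) = M ^ r := by
      rw [Nat.card_eq_fintype_card, Fintype.card_multiplicative, Fintype.card_fun, ZMod.card, hJ]
    rw [← Nat.card_coe_set_eq, ← Nat.card_coe_set_eq, Nat.card_range_of_injective hinj, hsrc]
    exact (h M dvd_rfl).le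
  · exact (Set.finite_coe_iff.mp (Nat.finite_of_card_ne_zero (α := {x : G // x ^ M = 1})
      (by rw [h M dvd_rfl]; exact pow_ne_zero _ hM.ne')))

/-- The injective homomorphism alone (★ `…_range_eq`). [cite: Hungerford1974, Ch. II Lemma 2.5 (vi), Cor. 2.7 (PDF p. 137–140)]
[cite: Rotman1984, Exercise 6.17] -/
theorem exists_mulHom_injective_of_forall_dvd_natCard_pow_eq_one {G : Type*} [CommGroup G] {M r : ℕ}
    (hM : 0 < M) (h : ∀ d, d ∣ M → Nat.card {x : G // x ^ d = 1} = d ^ r) (J : Type*) [Fintype J]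
    (hJ : Fintype.card J = r) :
    ∃ φ : Multiplicative (J → ZMod M) →* G, Function.Injective φ := by
  obtain ⟨φ, hφ, -⟩ := exists_mulHom_injective_range_eq_of_forall_dvd_natCard_pow_eq_one hM h J hJ
  exact ⟨φ, hφ⟩

/-- The ordered «`Σ aᵢ xᵢ`» product of ★ `LevelBasisFiniteEtaleCover` is the product over `Fin g ⊕ Fin g`.
[cite: MumfordFogartyKirwan1994, Ch. 7 §2 Definition 7.1 (p. 129)] -/
theorem listProd_pow_mul_listProd_pow_eq_prod {G : Type*} [CommMonoid G] {g M : ℕ} (x : Fin g ⊕ Fin g → G)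
    (a : Fin g ⊕ Fin g → ZMod M) :
    (List.ofFn fun i : Fin g => x (Sum.inl i) ^ (a (Sum.inl i)).val).prod *
        (List.ofFn fun i : Fin g => x (Sum.inr i) ^ (a (Sum.inr i)).val).prod = ∏ j, x j ^ (a j).val := by
  rw [List.prod_ofFn, List.prod_ofFn, Fintype.prod_sum_type]

/-- For a homomorphism `φ : Multiplicative (J → ℤ/M) →* G` and the images `xᵢ = φ(eᵢ)` of the standard basis,
`∏ᵢ xᵢ ^ aᵢ = φ(a)`. [cite: MumfordFogartyKirwan1994, Ch. 7 §2 Definition 7.1 (p. 129)] -/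
theorem prod_map_ofAdd_single_pow_val {G : Type*} [CommMonoid G] {J : Type*} [Fintype J] [DecidableEq J] {M : ℕ}
    [NeZero M] (φ : Multiplicative (J → ZMod M) →* G) (a : J → ZMod M) :
    ∏ i, φ (Multiplicative.ofAdd (Pi.single i 1)) ^ (a i).val = φ (Multiplicative.ofAdd a) := by
  have ha : ∑ i, (a i).val • (Pi.single i (1 : ZMod M) : J → ZMod M) = a := by
    conv_rhs => rw [← Finset.univ_sum_single a]
    refine Finset.sum_congr rfl fun i _ => ?_
    rw [← Pi.single_smul', nsmul_eq_mul, mul_one, ZMod.natCast_zmod_val]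
  conv_rhs => rw [← ha, ofAdd_sum, map_prod]
  refine Finset.prod_congr rfl fun i _ => ?_
  rw [ofAdd_nsmul, map_pow]

/-- **An ordered `ℤ/M`-basis from the torsion counts**, in the shape consumed by ★ `exists_finite_etale_levelStructure`:
if `|{x ∈ G | x ^ d = 1}| = d ^ (2g)` for every `d ∣ M` (`M ≥ 1`), there is `x : Fin g ⊕ Fin g → G` with `xᵢ ^ M = 1` on
which `a ↦ Σ aᵢ xᵢ` is injective. [cite: Hungerford1974, Ch. II Lemma 2.5 (vi), Cor. 2.7 (PDF p. 137–140)] [cite: Rotman1984, Exercise 6.17]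
[cite: MumfordFogartyKirwan1994, Ch. 7 §2 Definition 7.1 (p. 129)] -/
theorem exists_basis_of_forall_dvd_natCard_pow_eq_one {G : Type*} [CommGroup G] {g M : ℕ} (hM : 0 < M)
    (h : ∀ d, d ∣ M → Nat.card {x : G // x ^ d = 1} = d ^ (2 * g)) :
    ∃ x : Fin g ⊕ Fin g → G, (∀ i, x i ^ M = 1) ∧
      Function.Injective (fun a : Fin g ⊕ Fin g → ZMod M =>
        (List.ofFn fun i : Fin g => x (Sum.inl i) ^ (a (Sum.inl i)).val).prod *
          (List.ofFn fun i : Fin g => x (Sum.inr i) ^ (a (Sum.inr i)).val).prod) := by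
  classical
  haveI : NeZero M := ⟨hM.ne'⟩
  obtain ⟨φ, hφ⟩ := exists_mulHom_injective_of_forall_dvd_natCard_pow_eq_one hM h (Fin g ⊕ Fin g)
    (by rw [Fintype.card_sum, Fintype.card_fin, two_mul])
  refine ⟨fun j => φ (Multiplicative.ofAdd (Pi.single j 1)), fun j => ?_, ?_⟩
  · rw [← map_pow, ← ofAdd_nsmul]
    have h0 : M • (Pi.single j (1 : ZMod M) : Fin g ⊕ Fin g → ZMod M) = 0 := by
      rw [← Pi.single_smul', nsmul_eq_mul, mul_one, ZMod.natCast_self, Pi.single_zero]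
    rw [h0, ofAdd_zero, map_one]
  · have hfun : (fun a : Fin g ⊕ Fin g → ZMod M =>
        (List.ofFn fun i : Fin g => φ (Multiplicative.ofAdd (Pi.single (Sum.inl i) 1)) ^ (a (Sum.inl i)).val).prod *
          (List.ofFn fun i : Fin g => φ (Multiplicative.ofAdd (Pi.single (Sum.inr i) 1)) ^ (a (Sum.inr i)).val).prod) =
        fun a => φ (Multiplicative.ofAdd a) := by
      funext a
      rw [listProd_pow_mul_listProd_pow_eq_prod (fun j => φ (Multiplicative.ofAdd (Pi.single j 1))) a,
        prod_map_ofAdd_single_pow_val]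
    rw [hfun]
    exact hφ.comp Multiplicative.ofAdd.injective

end LevelBasis

/-! ### §2 `A_s̄(Ω)[M] ≅ (ℤ/M)^{2g}` at a geometric point, in the `FibrePoints` currency -/

namespace AbelianSchemeOver

open Literature.AlgebraicGeometry.Morphisms Literature.AlgebraicGeometry.Motives

variable {S : Scheme.{u}} (A : AbelianSchemeOver S)

/-- **`#A_s̄(Ω)[d] = d^{2g}` for `d ∣ M`** (★ `natCard_fibrePoints_pow_eq_one`, ★ `dim_fibre_of_isOfRelDim`).
[cite: MumfordAV1970, §6 Application 3 (Proposition p. 64)] [cite: GortzWedhorn2020, Section (4.7), (4.7.1) (p. 108)] -/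
theorem natCard_fibrePoints_pow_eq_one_of_dvd {Ω : Type u} [Field Ω] [IsAlgClosed Ω] (s : Spec (.of Ω) ⟶ S) {g M : ℕ}
    (hg : A.IsOfRelDim g) (hMΩ : (M : Ω) ≠ 0) {d : ℕ} (hd : d ∣ M) :
    Nat.card {y : A.FibrePoints s // y ^ d = 1} = d ^ (2 * g) := by
  have hdΩ : (d : Ω) ≠ 0 := by
    obtain ⟨k, hk⟩ := hd
    intro h0
    apply hMΩ
    rw [hk, Nat.cast_mul, h0, zero_mul]
  rw [A.natCard_fibrePoints_pow_eq_one s d hdΩ, dim_fibre_of_isOfRelDim hg s]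

/-- **`A_s̄(Ω)[M] ≅ (ℤ/M)^{2g}` (multiplicatively)**: for an abelian scheme `A/S` of relative dimension `g` with commutative
group law, a geometric point `s̄ : Spec Ω → S` (`Ω` algebraically closed) and `M ≥ 1` invertible in `Ω`, there is an
injective homomorphism `Multiplicative (Fin g ⊕ Fin g → ℤ/M) →* A.FibrePoints s̄` whose image is exactly the `M`-torsion
(§1 on the counts `#A_s̄(Ω)[d] = d^{2g}`, `d ∣ M`). [cite: GortzWedhorn2023, Prop. 27.188 (1) (p. 675)]
[cite: MumfordAV1970, §6 Application 3 (Proposition p. 64)] -/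
theorem exists_mulHom_torsion_fibrePoints [IsCommMonObj A.X] {Ω : Type u} [Field Ω] [IsAlgClosed Ω]
    (s : Spec (.of Ω) ⟶ S) {g M : ℕ} (hg : A.IsOfRelDim g) (hM : 0 < M) (hMΩ : (M : Ω) ≠ 0) :
    ∃ φ : Multiplicative (Fin g ⊕ Fin g → ZMod M) →* A.FibrePoints s,
      Function.Injective φ ∧ Set.range φ = {y | y ^ M = 1} :=
  LevelBasis.exists_mulHom_injective_range_eq_of_forall_dvd_natCard_pow_eq_one hM
    (fun _ hd => A.natCard_fibrePoints_pow_eq_one_of_dvd s hg hMΩ hd) (Fin g ⊕ Fin g)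
    (by rw [Fintype.card_sum, Fintype.card_fin, two_mul])

/-- **An ordered `ℤ/M`-basis of `A_s̄(Ω)[M]`** in the shape consumed by ★ `exists_finite_etale_levelStructure`: a family
`x : Fin g ⊕ Fin g → A.FibrePoints s̄` of `M`-torsion points on which `a ↦ Σ aᵢ xᵢ` is injective.
[cite: GortzWedhorn2023, Prop. 27.188 (1) (p. 675)] [cite: MumfordAV1970, §6 Application 3 (Proposition p. 64)]
[cite: MumfordFogartyKirwan1994, Ch. 7 §2 Definition 7.1 (p. 129)] -/
theorem exists_torsionBasis_fibrePoints [IsCommMonObj A.X] {Ω : Type u} [Field Ω] [IsAlgClosed Ω]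
    (s : Spec (.of Ω) ⟶ S) {g M : ℕ} (hg : A.IsOfRelDim g) (hM : 0 < M) (hMΩ : (M : Ω) ≠ 0) :
    ∃ x : Fin g ⊕ Fin g → A.FibrePoints s, (∀ i, x i ^ M = 1) ∧
      Function.Injective (fun a : Fin g ⊕ Fin g → ZMod M =>
        (List.ofFn fun i : Fin g => x (Sum.inl i) ^ (a (Sum.inl i)).val).prod *
          (List.ofFn fun i : Fin g => x (Sum.inr i) ^ (a (Sum.inr i)).val).prod) :=
  LevelBasis.exists_basis_of_forall_dvd_natCard_pow_eq_one hM fun _ hd =>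
    A.natCard_fibrePoints_pow_eq_one_of_dvd s hg hMΩ hd

/-! ### §3 The cover of level-`M` bases is surjective -/

/-- **A LEVEL-`M` STRUCTURE EXISTS OVER A FINITE ÉTALE COVER OF THE BASE** ([MumfordFogartyKirwan1994] Prop. 7.3, proof,
step (IV) / Lemma 7.11; [GortzWedhorn2023] Prop. 27.188 (1) «`X[n]` is étale-locally isomorphic to `(ℤ/nℤ)^{2g}`»).  Let
`A/S` be an abelian scheme of relative dimension `g` with commutative group law and `M ≠ 0` invertible in the residue fields
of `S`.  There are a finite étale SURJECTIVE `b : B → S` and a level-`M` structure on `A ×_S B`, realising every ordered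
`ℤ/M`-basis of the `M`-torsion of a fibre `A_s(Ω)` by a point of `B` over `s` (★ `exists_finite_etale_levelStructure`);
surjectivity: a point `p ∈ S` lies under the geometric point `s̄ : Spec κ(p)^{alg} → S`, in whose field `M` is invertible
(★ `natCast_ne_zero_of_residueField`) and whose fibre therefore carries a basis (§2), realised by a point of `B` over `s̄`.
[cite: MumfordFogartyKirwan1994, Ch. 7 §2 Proposition 7.3, proof, step (IV) (pp. 133–134)]
[cite: MumfordFogartyKirwan1994, Ch. 7 §3 Lemma 7.11 (p. 140)] [cite: GortzWedhorn2023, Prop. 27.188 (1) (p. 675)] -/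
theorem exists_finite_etale_surjective_levelStructure [IsCommMonObj A.X] {g M : ℕ} [NeZero M] (hg : A.IsOfRelDim g)
    (hM : ∀ s : S, (M : S.residueField s) ≠ 0) :
    ∃ (B : Scheme.{u}) (b : B ⟶ S), IsFinite b ∧ Etale b ∧ Surjective b ∧
      Nonempty (LevelStructure g M (A.baseChange b)) ∧
      ∀ ⦃Ω : Type u⦄ [Field Ω] (s : Spec (.of Ω) ⟶ S) (x : Fin g ⊕ Fin g → A.FibrePoints s),
        (∀ i, x i ^ M = 1) →
        Function.Injective (fun a : Fin g ⊕ Fin g → ZMod M =>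
          (List.ofFn fun i : Fin g => x (Sum.inl i) ^ (a (Sum.inl i)).val).prod *
            (List.ofFn fun i : Fin g => x (Sum.inr i) ^ (a (Sum.inr i)).val).prod) →
        ∃ t : Spec (.of Ω) ⟶ B, t ≫ b = s := by
  obtain ⟨B, b, hfin, het, hne, hreal⟩ := A.exists_finite_etale_levelStructure hg hM
  refine ⟨B, b, hfin, het, ⟨fun p => ?_⟩, hne, hreal⟩
  -- the geometric point `Spec κ(p)^alg → S` over `p` carries a basis of the `M`-torsion, realised by a point of `B`
  let Ω : Type u := AlgebraicClosure (S.residueField p)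
  let s₀ : Spec (.of Ω) ⟶ S :=
    Spec.map (CommRingCat.ofHom (algebraMap (S.residueField p) Ω)) ≫ S.fromSpecResidueField p
  have hs₀ : s₀.base (IsLocalRing.closedPoint Ω) = p := by
    change (S.fromSpecResidueField p).base _ = p
    exact Scheme.fromSpecResidueField_apply p _
  have hMΩ : (M : Ω) ≠ 0 := natCast_ne_zero_of_residueField s₀ M hM
  obtain ⟨x, hxM, hxinj⟩ := A.exists_torsionBasis_fibrePoints s₀ hg (NeZero.pos M) hMΩ
  obtain ⟨t, ht⟩ := hreal s₀ x hxM hxinj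
  refine ⟨t.base (IsLocalRing.closedPoint Ω), ?_⟩
  rw [← Scheme.Hom.comp_apply, ht, hs₀]

/-- The surjective cover alone: **every abelian scheme of relative dimension `g` with commutative group law admits a
level-`M` structure over some finite étale surjective `B → S`** (`M ≠ 0` invertible on `S`).
[cite: GortzWedhorn2023, Prop. 27.188 (1) (p. 675)] [cite: MumfordFogartyKirwan1994, Ch. 7 §3 Lemma 7.11 (p. 140)] -/
theorem exists_finite_etale_surjective_nonempty_levelStructure [IsCommMonObj A.X] {g M : ℕ} [NeZero M]
    (hg : A.IsOfRelDim g) (hM : ∀ s : S, (M : S.residueField s) ≠ 0) :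
    ∃ (B : Scheme.{u}) (b : B ⟶ S), IsFinite b ∧ Etale b ∧ Surjective b ∧
      Nonempty (LevelStructure g M (A.baseChange b)) := by
  obtain ⟨B, b, hfin, het, hsurj, hne, -⟩ := A.exists_finite_etale_surjective_levelStructure hg hM
  exact ⟨B, b, hfin, het, hsurj, hne⟩

end AbelianSchemeOver

end Literature.AlgebraicGeometry.AbelianSchemes

end
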